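import Summits.QuantumAdvantage.QuantumAdvantage.Theorems.CharDialWalkHardFSubLog
import Mathlib.Algebra.BigOperators.Group.Finset.Powerset
import HarnessLib

/-!
# Cell qa-qnc0 / decomp-qadv (odd primes): sub-characteristic junta law, part 1/3 — cube combinatorics

TREE-READY PART of the node `HOME/decomp-qadv-lens-6/g8/CharDial.lean` (decomp-qadv-lens-6 g8), ZERO
`def … : Prop` (statements inlined).  Pure combinatorics of the cube `{0,1}ⁿ`, no field in sight:

* §5 sensitivity and relevant variables: `flip`, `sensAt f x` (coordinates whose flip changes `f x`), `relVar f`;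
  `eq_of_agree_relVar` (a function depends only on its relevant variables); the hypercube min-degree lemma
  `two_pow_le_card_of_minDegree` (a nonempty vertex set closed in spirit: every member has `≥ m` neighbours inside,
  along a fixed direction set ⇒ `2^m ≤ |A|`); SIMON'S LEMMA in the form `card_relVar_le` / `junta_or_sensitive`:
  either some vertex has `≥ N` sensitive coordinates or `f` is an `N·4^N`-junta.
* §6 the finite off-diagonal RAMSEY THEOREM for `k`-uniform hypergraphs with two colours (Erdős–Rado recursion,
  uniform in the ground type) and its LAYERED corollary `layered_ramsey` (one `m`-set monochromatic in every
  layer `t ∈ [2, L]` simultaneously).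

Used by parts 2/3 (`SubCharBlocks`) and 3/3 (`SubCharJunta`).  Imports part 0 (`WalkHardFSubLog`, decomp-qadv-lens-6
g7) only to keep the landing chain linear.
-/

noncomputable section

namespace Summit.QuantumAdvantage.AdviceFreeQNC0

namespace SubChar

open Finset

variable {n : ℕ}

/-! ### §5 Sensitivity, relevant variables, juntas (Simon's lemma) -/

/-- Flip coordinate `i`. -/
def flip (i : Fin n) (x : Fin n → Bool) : Fin n → Bool := Function.update x i (!x i)

/-- CharDial sub-characteristic helper `flip_apply_same` (lens-6 g8 LAND package; see the module docstring). -/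
@[simp] theorem flip_apply_same (i : Fin n) (x : Fin n → Bool) : flip i x i = !x i := by
  simp [flip]

/-- CharDial sub-characteristic helper `flip_apply_of_ne` (lens-6 g8 LAND package; see the module docstring). -/
theorem flip_apply_of_ne {i j : Fin n} (h : j ≠ i) (x : Fin n → Bool) : flip i x j = x j := by
  simp [flip, Function.update_of_ne h]

/-- CharDial sub-characteristic helper `flip_flip` (lens-6 g8 LAND package; see the module docstring). -/
theorem flip_flip (i : Fin n) (x : Fin n → Bool) : flip i (flip i x) = x := by
  funext j
  by_cases h : j = i
  · subst h; simp
  · rw [flip_apply_of_ne h, flip_apply_of_ne h]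

/-- CharDial sub-characteristic helper `flip_comm` (lens-6 g8 LAND package; see the module docstring). -/
theorem flip_comm (i j : Fin n) (x : Fin n → Bool) : flip i (flip j x) = flip j (flip i x) := by
  by_cases hij : i = j
  · subst hij; rfl
  funext k
  by_cases hki : k = i
  · subst hki
    rw [flip_apply_same, flip_apply_of_ne hij, flip_apply_of_ne hij, flip_apply_same]
  · by_cases hkj : k = j
    · subst hkj
      rw [flip_apply_of_ne hki, flip_apply_same, flip_apply_same, flip_apply_of_ne hki]
    · rw [flip_apply_of_ne hki, flip_apply_of_ne hkj, flip_apply_of_ne hkj, flip_apply_of_ne hki]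

/-- The coordinates sensitive at `x`. -/
def sensAt (f : (Fin n → Bool) → Bool) (x : Fin n → Bool) : Finset (Fin n) :=
  univ.filter fun i => f (flip i x) ≠ f x

/-- The relevant (non-fictitious) variables of `f`. -/
def relVar (f : (Fin n → Bool) → Bool) : Finset (Fin n) := by
  classical exact univ.filter fun i => ∃ x, f (flip i x) ≠ f x

/-- CharDial sub-characteristic helper `mem_sensAt` (lens-6 g8 LAND package; see the module docstring). -/
theorem mem_sensAt {f : (Fin n → Bool) → Bool} {x : Fin n → Bool} {i : Fin n} :
    i ∈ sensAt f x ↔ f (flip i x) ≠ f x := by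
  simp [sensAt]

/-- CharDial sub-characteristic helper `mem_relVar` (lens-6 g8 LAND package; see the module docstring). -/
theorem mem_relVar {f : (Fin n → Bool) → Bool} {i : Fin n} : i ∈ relVar f ↔ ∃ x, f (flip i x) ≠ f x := by
  classical
  simp [relVar]

/-- A Boolean function is determined by its relevant variables. -/
theorem eq_of_agree_relVar (f : (Fin n → Bool) → Bool) :
    ∀ u v : Fin n → Bool, (∀ i ∈ relVar f, u i = v i) → f u = f v := by
  classical
  suffices h : ∀ k : ℕ, ∀ u v : Fin n → Bool, (univ.filter fun i => u i ≠ v i).card ≤ k →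
      (∀ i ∈ relVar f, u i = v i) → f u = f v from
    fun u v => h _ u v le_rfl
  intro k
  induction k with
  | zero =>
    intro u v hk _
    have huv : u = v := by
      funext i
      by_contra hi
      have hmem : i ∈ univ.filter fun i => u i ≠ v i := by simpa using hi
      rw [Nat.le_zero, Finset.card_eq_zero] at hk
      rw [hk] at hmem
      simp at hmem
    rw [huv]
  | succ k ih =>
    intro u v hk hagree
    by_cases huv : u = v
    · rw [huv]
    obtain ⟨i, hi⟩ : ∃ i, u i ≠ v i := by
      by_contra h
      push Not at h
      exact huv (funext h)
    have hirr : i ∉ relVar f := fun h => hi (hagree i h)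
    have hflip : f (flip i u) = f u := by
      by_contra hne
      exact hirr (mem_relVar.2 ⟨u, hne⟩)
    rw [← hflip]
    apply ih
    · have hsub : (univ.filter fun j => flip i u j ≠ v j) ⊆ (univ.filter fun j => u j ≠ v j).erase i := by
        intro j hj
        simp only [Finset.mem_filter, Finset.mem_univ, true_and] at hj
        rw [Finset.mem_erase, Finset.mem_filter]
        by_cases hji : j = i
        · subst hji
          rw [flip_apply_same] at hj
          exfalso
          apply hj
          revert hi
          cases u j <;> cases v j <;> simp
        · rw [flip_apply_of_ne hji] at hj
          exact ⟨hji, Finset.mem_univ _, hj⟩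
      have hmem : i ∈ univ.filter fun j => u j ≠ v j := by simpa using hi
      have h1 := Finset.card_le_card hsub
      have h2 := Finset.card_erase_of_mem hmem
      omega
    · intro j hj
      have hji : j ≠ i := fun h => hirr (h ▸ hj)
      rw [flip_apply_of_ne hji]
      exact hagree j hj

/-- **Hypercube min-degree lemma** (Simon 1983): a nonempty vertex set `X` of the cube in which every vertex has
at least `k` neighbours inside `X` (along coordinates from `D`) has at least `2^k` elements. -/
theorem two_pow_le_card_of_minDegree (D : Finset (Fin n)) :
    ∀ (X : Finset (Fin n → Bool)) (k : ℕ), X.Nonempty →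
      (∀ x ∈ X, k ≤ (D.filter fun j => flip j x ∈ X).card) → 2 ^ k ≤ X.card := by
  induction D using Finset.strongInduction with
  | H D ih =>
  intro X k hne hdeg
  cases k with
  | zero => simpa using hne.card_pos
  | succ k =>
    obtain ⟨x₀, hx₀⟩ := hne
    have hpos : 0 < (D.filter fun j => flip j x₀ ∈ X).card := lt_of_lt_of_le (Nat.succ_pos k) (hdeg x₀ hx₀)
    obtain ⟨j, hj⟩ := Finset.card_pos.1 hpos
    rw [Finset.mem_filter] at hj
    obtain ⟨hjD, hjX⟩ := hj
    have key : ∀ b : Bool, 2 ^ k ≤ (X.filter fun x => x j = b).card := by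
      intro b
      apply ih (D.erase j) (Finset.erase_ssubset hjD)
      · by_cases hb : x₀ j = b
        · exact ⟨x₀, by simp [hx₀, hb]⟩
        · refine ⟨flip j x₀, ?_⟩
          simp only [Finset.mem_filter, flip_apply_same]
          refine ⟨hjX, ?_⟩
          revert hb
          cases x₀ j <;> cases b <;> simp
      · intro x hx
        rw [Finset.mem_filter] at hx
        obtain ⟨hxX, hxj⟩ := hx
        have hsub : (D.filter fun j' => flip j' x ∈ X).erase j ⊆
            (D.erase j).filter fun j' => flip j' x ∈ X.filter fun x => x j = b := by
          intro j' hj'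
          rw [Finset.mem_erase, Finset.mem_filter] at hj'
          obtain ⟨hne, hj'D, hj'X⟩ := hj'
          rw [Finset.mem_filter, Finset.mem_erase, Finset.mem_filter]
          exact ⟨⟨hne, hj'D⟩, hj'X, by rw [flip_apply_of_ne (Ne.symm hne)]; exact hxj⟩
        have h1 := hdeg x hxX
        have h2 := Finset.card_le_card hsub
        have h3 := Finset.pred_card_le_card_erase (s := D.filter fun j' => flip j' x ∈ X) (a := j)
        omega
    have hsplit := Finset.card_filter_add_card_filter_not (s := X) (fun x => x j = false)
    have hneg : (X.filter fun x => ¬ x j = false) = X.filter fun x => x j = true :=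
      Finset.filter_congr fun x _ => by simp
    rw [hneg] at hsplit
    have h0 := key false
    have h1 := key true
    rw [pow_succ]
    omega

/-- Double counting of (coordinate, vertex) sensitivity incidences. -/
theorem sum_card_sensAt (f : (Fin n → Bool) → Bool) :
    ∑ i : Fin n, (univ.filter fun x : Fin n → Bool => f (flip i x) ≠ f x).card =
      ∑ x : Fin n → Bool, (sensAt f x).card := by
  simp only [sensAt, Finset.card_filter]
  exact Finset.sum_comm

/-- **Weak Simon bound**: if no vertex has `N` sensitive coordinates, then `f` has at most `N · 4^N` relevant
variables. -/
theorem card_relVar_le (f : (Fin n → Bool) → Bool) (N : ℕ) (hN : ∀ x, (sensAt f x).card < N) :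
    (relVar f).card ≤ N * 4 ^ N := by
  classical
  have hN1 : 1 ≤ N := by have := hN (fun _ => false); omega
  have h4 : 4 ≤ 4 ^ N := by
    calc (4 : ℕ) = 4 ^ 1 := by norm_num
      _ ≤ 4 ^ N := Nat.pow_le_pow_right (by norm_num) hN1
  by_cases hn : n < 2 * N
  · calc (relVar f).card ≤ (univ : Finset (Fin n)).card := Finset.card_le_card (Finset.subset_univ _)
      _ = n := by simp
      _ ≤ N * 4 ^ N := by nlinarith
  · push Not at hn
    have hX : ∀ i ∈ relVar f, 2 ^ (n - 2 * (N - 1)) ≤ (univ.filter fun x => f (flip i x) ≠ f x).card := by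
      intro i hi
      have hne : (univ.filter fun x : Fin n → Bool => f (flip i x) ≠ f x).Nonempty := by
        obtain ⟨x, hx⟩ := mem_relVar.1 hi
        exact ⟨x, by simpa using hx⟩
      refine two_pow_le_card_of_minDegree univ _ _ hne fun x hx => ?_
      have hx' : f (flip i x) ≠ f x := by simpa using hx
      have hsub : univ \ (sensAt f x ∪ sensAt f (flip i x)) ⊆
          univ.filter fun j => flip j x ∈ univ.filter fun x => f (flip i x) ≠ f x := by
        intro j hj
        simp only [Finset.mem_sdiff, Finset.mem_univ, true_and, Finset.mem_union, not_or, mem_sensAt,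
          not_not] at hj
        simp only [Finset.mem_filter, Finset.mem_univ, true_and]
        rw [flip_comm, hj.2, hj.1]
        exact hx'
      calc n - 2 * (N - 1) ≤ n - (sensAt f x ∪ sensAt f (flip i x)).card := by
            have hu := Finset.card_union_le (sensAt f x) (sensAt f (flip i x))
            have h1 := hN x
            have h2 := hN (flip i x)
            omega
        _ = (univ \ (sensAt f x ∪ sensAt f (flip i x))).card := by
            rw [Finset.card_univ_sdiff]; simp
        _ ≤ _ := Finset.card_le_card hsub
    have hsum : (relVar f).card * 2 ^ (n - 2 * (N - 1)) ≤ 2 ^ n * (N - 1) := by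
      calc (relVar f).card * 2 ^ (n - 2 * (N - 1)) = ∑ i ∈ relVar f, 2 ^ (n - 2 * (N - 1)) := by simp
        _ ≤ ∑ i ∈ relVar f, (univ.filter fun x => f (flip i x) ≠ f x).card := Finset.sum_le_sum hX
        _ ≤ ∑ i : Fin n, (univ.filter fun x => f (flip i x) ≠ f x).card :=
            Finset.sum_le_sum_of_subset_of_nonneg (Finset.subset_univ _) (fun _ _ _ => Nat.zero_le _)
        _ = ∑ x : Fin n → Bool, (sensAt f x).card := sum_card_sensAt f
        _ ≤ ∑ x : Fin n → Bool, (N - 1) := Finset.sum_le_sum fun x _ => by have := hN x; omega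
        _ = 2 ^ n * (N - 1) := by simp
    have h2n : 2 ^ n = 2 ^ (2 * (N - 1)) * 2 ^ (n - 2 * (N - 1)) := by
      rw [← pow_add]; congr 1; omega
    have hpos : 0 < 2 ^ (n - 2 * (N - 1)) := pow_pos (by norm_num) _
    have key : (relVar f).card * 2 ^ (n - 2 * (N - 1)) ≤ ((N - 1) * 2 ^ (2 * (N - 1))) * 2 ^ (n - 2 * (N - 1)) := by
      calc (relVar f).card * 2 ^ (n - 2 * (N - 1)) ≤ 2 ^ n * (N - 1) := hsum
        _ = ((N - 1) * 2 ^ (2 * (N - 1))) * 2 ^ (n - 2 * (N - 1)) := by rw [h2n]; ring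
    have hle : (relVar f).card ≤ (N - 1) * 2 ^ (2 * (N - 1)) := Nat.le_of_mul_le_mul_right key hpos
    have h42 : 2 ^ (2 * (N - 1)) = 4 ^ (N - 1) := by rw [pow_mul]; norm_num
    rw [h42] at hle
    have h4le : 4 ^ (N - 1) ≤ 4 ^ N := Nat.pow_le_pow_right (by norm_num) (Nat.sub_le N 1)
    calc (relVar f).card ≤ (N - 1) * 4 ^ (N - 1) := hle
      _ ≤ N * 4 ^ N := Nat.mul_le_mul (Nat.sub_le N 1) h4le

/-- **Junta-or-sensitive dichotomy**: either some vertex has `N` sensitive coordinates, or `f` is an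
`N·4^N`-junta. -/
theorem junta_or_sensitive (f : (Fin n → Bool) → Bool) (N : ℕ) :
    (∃ x, N ≤ (sensAt f x).card) ∨
      ∃ J : Finset (Fin n), J.card ≤ N * 4 ^ N ∧ ∀ u v : Fin n → Bool, (∀ i ∈ J, u i = v i) → f u = f v := by
  by_cases h : ∃ x, N ≤ (sensAt f x).card
  · exact Or.inl h
  · push Not at h
    exact Or.inr ⟨relVar f, card_relVar_le f N h, eq_of_agree_relVar f⟩

/-! ### §6 Finite Ramsey theorem for 2-coloured uniform hypergraphs (Erdős–Rado recursion)

No `def … : Prop`: "every `k`-subset of `S` has colour `c`" is written out as `∀ T ⊆ S, T.card = k → χ T = c`, and the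
Ramsey property `R(k; s, t) ≤ N` is inlined in the three statements below (UNIFORM in the ground type `α`). -/

/-- CharDial sub-characteristic helper `mono_subset` (lens-6 g8 LAND package; see the module docstring). -/
theorem mono_subset {α : Type*} {χ : Finset α → Bool} {k : ℕ} {S S' : Finset α} {c : Bool}
    (h : ∀ T ⊆ S, T.card = k → χ T = c) (hS : S' ⊆ S) : ∀ T ⊆ S', T.card = k → χ T = c :=
  fun T hT hk => h T (hT.trans hS) hk

/-- CharDial sub-characteristic helper `ramsey_zero` (lens-6 g8 LAND package; see the module docstring). -/
theorem ramsey_zero (s t : ℕ) : ∃ N : ℕ, ∀ (α : Type) [DecidableEq α] (V : Finset α) (χ : Finset α → Bool),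
    N ≤ V.card →
      (∃ S ⊆ V, s ≤ S.card ∧ ∀ T ⊆ S, T.card = 0 → χ T = true) ∨
        (∃ S ⊆ V, t ≤ S.card ∧ ∀ T ⊆ S, T.card = 0 → χ T = false) := by
  refine ⟨max s t, fun α _ V χ hV => ?_⟩
  cases hc : χ ∅ with
  | true =>
    exact Or.inl ⟨V, subset_rfl, le_of_max_le_left hV, fun T _ hT => by rw [Finset.card_eq_zero.1 hT, hc]⟩
  | false =>
    exact Or.inr ⟨V, subset_rfl, le_of_max_le_right hV, fun T _ hT => by rw [Finset.card_eq_zero.1 hT, hc]⟩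

/-- CharDial sub-characteristic helper `ramsey_succ` (lens-6 g8 LAND package; see the module docstring). -/
theorem ramsey_succ {k : ℕ}
    (ihk : ∀ s t : ℕ, ∃ N : ℕ, ∀ (α : Type) [DecidableEq α] (V : Finset α) (χ : Finset α → Bool), N ≤ V.card →
      (∃ S ⊆ V, s ≤ S.card ∧ ∀ T ⊆ S, T.card = k → χ T = true) ∨
        (∃ S ⊆ V, t ≤ S.card ∧ ∀ T ⊆ S, T.card = k → χ T = false)) :
    ∀ s t : ℕ, ∃ N : ℕ, ∀ (α : Type) [DecidableEq α] (V : Finset α) (χ : Finset α → Bool), N ≤ V.card →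
      (∃ S ⊆ V, s ≤ S.card ∧ ∀ T ⊆ S, T.card = k + 1 → χ T = true) ∨
        (∃ S ⊆ V, t ≤ S.card ∧ ∀ T ⊆ S, T.card = k + 1 → χ T = false) := by
  suffices h : ∀ m s t, s + t = m → ∃ N : ℕ, ∀ (α : Type) [DecidableEq α] (V : Finset α) (χ : Finset α → Bool),
      N ≤ V.card →
        (∃ S ⊆ V, s ≤ S.card ∧ ∀ T ⊆ S, T.card = k + 1 → χ T = true) ∨
          (∃ S ⊆ V, t ≤ S.card ∧ ∀ T ⊆ S, T.card = k + 1 → χ T = false) from fun s t => h _ s t rfl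
  intro m
  induction m with
  | zero =>
    intro s t hst
    refine ⟨0, fun α _ V χ _ => Or.inl ⟨∅, Finset.empty_subset _, by omega, fun T hT hk => ?_⟩⟩
    rw [Finset.subset_empty.1 hT, Finset.card_empty] at hk
    omega
  | succ m ih =>
    intro s t hst
    cases s with
    | zero =>
      refine ⟨0, fun α _ V χ _ => Or.inl ⟨∅, Finset.empty_subset _, le_rfl, fun T hT hk => ?_⟩⟩
      rw [Finset.subset_empty.1 hT, Finset.card_empty] at hk
      omega
    | succ s =>
    cases t with
    | zero =>
      refine ⟨0, fun α _ V χ _ => Or.inr ⟨∅, Finset.empty_subset _, le_rfl, fun T hT hk => ?_⟩⟩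
      rw [Finset.subset_empty.1 hT, Finset.card_empty] at hk
      omega
    | succ t =>
    obtain ⟨N₁, hN₁⟩ := ih s (t + 1) (by omega)
    obtain ⟨N₂, hN₂⟩ := ih (s + 1) t (by omega)
    obtain ⟨N₀, hN₀⟩ := ihk N₁ N₂
    refine ⟨N₀ + 1, fun α _ V χ hV => ?_⟩
    obtain ⟨v, hv⟩ : V.Nonempty := Finset.card_pos.1 (by omega)
    have hV'card : N₀ ≤ (V.erase v).card := by rw [Finset.card_erase_of_mem hv]; omega
    have hlift : ∀ (A : Finset α) (c : Bool), A ⊆ V.erase v →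
        (∀ T ⊆ A, T.card = k → χ (insert v T) = c) →
        ∀ S ⊆ A, (∀ T ⊆ S, T.card = k + 1 → χ T = c) → ∀ T ⊆ insert v S, T.card = k + 1 → χ T = c := by
      intro A c hAV' hA S hSA hS T hT hTk
      by_cases hvT : v ∈ T
      · rw [← Finset.insert_erase hvT]
        apply hA
        · intro x hx
          rw [Finset.mem_erase] at hx
          exact hSA (((Finset.mem_insert.1 (hT hx.2))).resolve_left hx.1)
        · rw [Finset.card_erase_of_mem hvT, hTk]
          omega
      · exact hS T (fun x hx => (Finset.mem_insert.1 (hT hx)).resolve_left fun h => hvT (h ▸ hx)) hTk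
    rcases hN₀ α (V.erase v) (fun T => χ (insert v T)) hV'card with ⟨A, hAV', hAcard, hA⟩ | ⟨B, hBV', hBcard, hB⟩
    · have hvA : v ∉ A := fun h => Finset.notMem_erase v V (hAV' h)
      have hAV : A ⊆ V := hAV'.trans (Finset.erase_subset v V)
      rcases hN₁ α A χ hAcard with ⟨S, hSA, hScard, hS⟩ | ⟨S, hSA, hScard, hS⟩
      · refine Or.inl ⟨insert v S, Finset.insert_subset hv (hSA.trans hAV), ?_, hlift A true hAV' hA S hSA hS⟩
        rw [Finset.card_insert_of_notMem fun h => hvA (hSA h)]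
        omega
      · exact Or.inr ⟨S, hSA.trans hAV, hScard, hS⟩
    · have hvB : v ∉ B := fun h => Finset.notMem_erase v V (hBV' h)
      have hBV : B ⊆ V := hBV'.trans (Finset.erase_subset v V)
      rcases hN₂ α B χ hBcard with ⟨S, hSB, hScard, hS⟩ | ⟨S, hSB, hScard, hS⟩
      · exact Or.inl ⟨S, hSB.trans hBV, hScard, hS⟩
      · refine Or.inr ⟨insert v S, Finset.insert_subset hv (hSB.trans hBV), ?_, hlift B false hBV' hB S hSB hS⟩
        rw [Finset.card_insert_of_notMem fun h => hvB (hSB h)]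
        omega

/-- **Ramsey's theorem for `k`-uniform hypergraphs, two colours** (finite, off-diagonal, uniform in the ground type). -/
theorem ramsey (k s t : ℕ) : ∃ N : ℕ, ∀ (α : Type) [DecidableEq α] (V : Finset α) (χ : Finset α → Bool),
    N ≤ V.card →
      (∃ S ⊆ V, s ≤ S.card ∧ ∀ T ⊆ S, T.card = k → χ T = true) ∨
        (∃ S ⊆ V, t ≤ S.card ∧ ∀ T ⊆ S, T.card = k → χ T = false) := by
  induction k generalizing s t with
  | zero => exact ramsey_zero s t
  | succ k ih => exact ramsey_succ ih s t

/-- **Layered Ramsey**: every large enough finite set has an `m`-subset on which, for each `t ∈ [2, L]`, all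
`t`-subsets carry the same colour. -/
theorem layered_ramsey (m : ℕ) : ∀ L : ℕ, ∃ M : ℕ, ∀ (α : Type) [DecidableEq α] (V : Finset α)
    (χ : Finset α → Bool), M ≤ V.card →
      ∃ Y ⊆ V, Y.card = m ∧ ∀ t, 2 ≤ t → t ≤ L → ∃ c, ∀ T ⊆ Y, T.card = t → χ T = c := by
  intro L
  induction L with
  | zero =>
    refine ⟨m, fun α _ V χ hV => ?_⟩
    obtain ⟨Y, hYV, hY⟩ := Finset.exists_subset_card_eq hV
    exact ⟨Y, hYV, hY, fun t h2 h0 => by omega⟩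
  | succ L ih =>
    obtain ⟨M, hM⟩ := ih
    obtain ⟨N, hN⟩ := ramsey (L + 1) M M
    refine ⟨N, fun α _ V χ hV => ?_⟩
    have hmono : ∃ S ⊆ V, M ≤ S.card ∧ ∃ c, ∀ T ⊆ S, T.card = L + 1 → χ T = c := by
      rcases hN α V χ hV with ⟨S, hSV, hSc, hS⟩ | ⟨S, hSV, hSc, hS⟩
      · exact ⟨S, hSV, hSc, true, hS⟩
      · exact ⟨S, hSV, hSc, false, hS⟩
    obtain ⟨S, hSV, hSc, c, hS⟩ := hmono
    obtain ⟨Y, hYS, hYm, hY⟩ := hM α S χ hSc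
    refine ⟨Y, hYS.trans hSV, hYm, fun t h2 ht => ?_⟩
    by_cases htL : t ≤ L
    · exact hY t h2 htL
    · have htL' : t = L + 1 := by omega
      subst htL'
      exact ⟨c, mono_subset hS hYS⟩

end SubChar

end Summit.QuantumAdvantage.AdviceFreeQNC0

end
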